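import Mathlib
import Summits.Ventures.PercRepro2.Defs
import Summits.Ventures.PercRepro2.Graph
import Summits.Ventures.PercRepro2.OneColourSwitch
import Summits.Ventures.PercRepro2.RegionHubSign
import Summits.Ventures.PercRepro2.SideSwitch
import Summits.Ventures.PercRepro2.SideSwitchFibre
import Summits.Ventures.PercRepro2.SideSwitchClosed
import Summits.Ventures.PercRepro2.SideSwitchComps
import Summits.Ventures.PercRepro2.SideSwitchCompsFibre
import Summits.Ventures.PercRepro2.M9NoPocketDefs
import Summits.Ventures.PercRepro2.M9NoPocketWorld
import Summits.Ventures.PercRepro2.M9NoPocketWorldD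
import Summits.Ventures.PercRepro2.M9NoPocketCompl
import Summits.Ventures.PercRepro2.M9DAvoid
import Summits.Ventures.PercRepro2.M9RegionSplit
import Summits.Ventures.PercRepro2.M9PocketCubeDefs
import Summits.Ventures.PercRepro2.M9PocketCubeMono
import Summits.Ventures.PercRepro2.M9PocketCubeHub

/-!
# The block-group cube WITH a pocket — the cube complement is the colour flip (blind cell
PercRepro2, p3 g23, 2026-08-28; `proofs/P3-HARRIS.md` §3)

The complement `cdualP ρ x = (blocks ∖ x.1, freeE ∖ x.2)` of a vector of the pocket cube: its
assignment is the colour flip of the assignment of `x` on every edge not inside `{r, s}`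
(`compl_assignX_eq_cdualP_off_rs`), because every edge of the graph is inside `{r, s}`, touches
exactly one block, or is a free edge (`edge_trichotomy`).  Hence the `Y`-connection `p ~_Y q`
of `G − d` at the complement is the `W`-connection at `x` (`conn_endsD_cdualP_iff`), and the
`d`-avoiding colour preference `σ̃_pq` is `f x − f (cdualP ρ x)` for `f = 1[p ~_Y q in G − d]`
(`sigma_endsD_eq_sub_cdualP`) — the shape of the tilt lemma of `M9HarrisCube`.  Own work; std
axioms.
-/

namespace Summit.Ventures.PercRepro2

namespace NoPocket

open Finset Classical RegionHub OneColourSwitch SideSwitch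

variable {V : Type*} {E : Type*}

section Compl

variable [Fintype V] [DecidableEq V] [Fintype E] [DecidableEq E]

variable (ends : E → Sym2 V)

/-- The cube complement: the complementary blocks and the complementary free edges. -/
noncomputable def cdualP (d r s : V) (ρ : Config E) (x : Finset (Finset V) × Finset E) :
    Finset (Finset V) × Finset E :=
  (blocks ends d r s ρ \ x.1, freeE ends d r s ρ \ x.2)

variable {ends}

/-- The complement lies in the cube. -/
lemma cdualP_mem_cubeP {d r s : V} (ρ : Config E) (x : Finset (Finset V) × Finset E) :
    cdualP ends d r s ρ x ∈ cubeP ends d r s ρ :=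
  mem_cubeP.2 ⟨Finset.sdiff_subset, Finset.sdiff_subset⟩

/-- The complement is an involution on the cube. -/
lemma cdualP_cdualP {d r s : V} {ρ : Config E} {x : Finset (Finset V) × Finset E}
    (hx : x ∈ cubeP ends d r s ρ) : cdualP ends d r s ρ (cdualP ends d r s ρ x) = x := by
  obtain ⟨hT, hF⟩ := mem_cubeP.1 hx
  simp only [cdualP]
  rw [Finset.sdiff_sdiff_eq_self hT, Finset.sdiff_sdiff_eq_self hF]

/-- The complement is antitone. -/
lemma cdualP_antitone {d r s : V} (ρ : Config E) {x x' : Finset (Finset V) × Finset E}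
    (hxx' : x ≤ x') : cdualP ends d r s ρ x' ≤ cdualP ends d r s ρ x :=
  ⟨Finset.sdiff_subset_sdiff le_rfl hxx'.1, Finset.sdiff_subset_sdiff le_rfl hxx'.2⟩

/-- An edge with an endpoint in a block does not touch a switched union unless its block is
switched; its value in an assignment is flipped iff its block is switched. -/
lemma assignX_touch_block {p q r s d : V} {ρ : Config E} (hρ : ρ ∈ RepD ends p q r s d)
    {x : Finset (Finset V) × Finset E} (hT : x.1 ⊆ blocks ends d r s ρ)
    (hF : x.2 ⊆ freeE ends d r s ρ) (hr : d ≠ r) (hs : d ≠ s) {C : Finset V}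
    (hC : C ∈ blocks ends d r s ρ) {y z : V} (hy : y ∈ C) {e : E} (he : ends e = s(y, z)) :
    assignX ends x ρ e = (if C ∈ x.1 then !ρ e else ρ e) := by
  have hyA : y ∈ A0 (endsD ends d) r s ρ := subset_A0_of_mem_comps (ends := endsD ends d) hC hy
  obtain ⟨hyU, hyr, hys⟩ := mem_A0.1 hyA
  have hyd : y ≠ d := (block_vertex_ne hρ hC hy hr hs).2.2
  have hnotT : e ∉ x.2 := fun h => by
    rcases mem_freeE.1 (hF h) with h' | h'
    · rcases mem_Tset.1 h' with h'' | h'' <;> rw [he, Sym2.eq_iff] at h''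
      · rcases h'' with ⟨h1, _⟩ | ⟨h1, _⟩
        · exact hyd h1
        · exact hyr h1
      · rcases h'' with ⟨h1, _⟩ | ⟨h1, _⟩
        · exact hyd h1
        · exact hys h1
    · exact not_mem_within_Oprime_of_mem_world he hyU (mem_Pk.1 h')
  have hval : flipF x.2 ρ e = ρ e := flipF_of_notMem hnotT
  by_cases hCx : C ∈ x.1
  · rw [if_pos hCx, assignX, flipTouch_of_mem ends
      ⟨y, Finset.mem_coe.2 (mem_unionT.2 ⟨C, hCx, hy⟩), z, he⟩, hval]
  · rw [if_neg hCx, assignX, flipTouch_of_notMem ends, hval]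
    rintro ⟨w, hw, v, hwv⟩
    rw [he, Sym2.eq_iff] at hwv
    rcases hwv with ⟨h1, _⟩ | ⟨_, h2⟩
    · rw [← h1] at hw
      exact hCx (block_mem_of_mem_unionT hρ hT hC hy (Finset.mem_coe.1 hw))
    · rw [← h2] at hw
      -- `z` lies in a switched block; the edge `y–z` puts `z` into the block of `y`
      obtain ⟨C', hC', hzC'⟩ := mem_unionT.1 (Finset.mem_coe.1 hw)
      have hzA : z ∈ A0 (endsD ends d) r s ρ :=
        subset_A0_of_mem_comps (ends := endsD ends d) (hT hC') hzC'
      have hzd : z ≠ d := (block_vertex_ne hρ (hT hC') hzC' hr hs).2.2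
      have hzC : z ∈ C := by
        have hcl := closedIn_of_mem_comps (ends := endsD ends d) hC
        have hends' : endsD ends d e = s(y, z) := by
          rw [endsD_of_notMem (notMem_of_ends_ne he hyd hzd), he]
        rw [sided_eq_coe_A0] at hcl
        exact Finset.mem_coe.1 (hcl e y z hends' (Finset.mem_coe.2 hy) (Finset.mem_coe.2 hzA))
      exact hCx (block_mem_of_mem_unionT hρ hT hC hzC (Finset.mem_coe.1 hw))

/-- **Edge trichotomy**: every edge is inside `{r, s}`, has an endpoint in a block, or is a free
edge (a `T`-edge or a pocket edge). -/
lemma edge_trichotomy {p q r s d : V} (hr : d ≠ r) (hs : d ≠ s) {ρ : Config E}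
    (hρ : ρ ∈ RepD ends p q r s d) (e : E) :
    e ∈ within ends ({r, s} : Set V) ∨
      (∃ C ∈ blocks ends d r s ρ, ∃ y ∈ C, ∃ z, ends e = s(y, z)) ∨ e ∈ freeE ends d r s ρ := by
  obtain ⟨⟨y, z⟩, hyz⟩ := Quot.exists_rep (ends e)
  have he : ends e = s(y, z) := hyz.symm
  -- a vertex is a block vertex, or `r`, `s`, or a pocket vertex
  have cases : ∀ v, (∃ C ∈ blocks ends d r s ρ, v ∈ C) ∨ v = r ∨ v = s ∨ v ∈ Oprime ends d r s ρ := by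
    intro v
    by_cases hvr : v = r
    · exact Or.inr (Or.inl hvr)
    by_cases hvs : v = s
    · exact Or.inr (Or.inr (Or.inl hvs))
    rcases mem_Oprime_or_block (ends := ends) (d := d) ρ hvr hvs with h | h
    · exact Or.inr (Or.inr (Or.inr h))
    · exact Or.inl h
  rcases cases y with ⟨C, hC, hyC⟩ | hy
  · exact Or.inr (Or.inl ⟨C, hC, y, hyC, z, he⟩)
  rcases cases z with ⟨C, hC, hzC⟩ | hz
  · exact Or.inr (Or.inl ⟨C, hC, z, hzC, y, by rw [he, Sym2.eq_swap]⟩)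
  -- neither endpoint is a block vertex
  have key : ∀ a b, (a = r ∨ a = s) → b ∈ Oprime ends d r s ρ → ends e = s(a, b) → e ∈ freeE ends d r s ρ := by
    intro a b hab hb hab'
    by_cases hbd : b = d
    · subst hbd
      refine mem_freeE.2 (Or.inl (mem_Tset.2 ?_))
      rcases hab with rfl | rfl
      · exact Or.inl (by rw [hab', Sym2.eq_swap])
      · exact Or.inr (by rw [hab', Sym2.eq_swap])
    · exfalso
      have had : a ≠ d := by rcases hab with rfl | rfl; exact hr.symm; exact hs.symm
      have hends' : endsD ends d e = s(a, b) := by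
        rw [endsD_of_notMem (notMem_of_ends_ne hab' had hbd), hab']
      have haK : a ∈ K2 (endsD ends d) r s ρ := by
        rcases hab with rfl | rfl
        · exact r_mem_K2 _ _ _
        · exact s_mem_K2 _ _ _
      have haM : a ∈ M2 (endsD ends d) r s ρ := by
        rcases hab with rfl | rfl
        · exact r_mem_M2 _ _ _
        · exact s_mem_M2 _ _ _
      by_cases hρe : ρ e = true
      · exact (mem_Oprime.1 hb).1 (mem_K2_of_open haK hρe hends')
      · exact (mem_Oprime.1 hb).2 (mem_M2_of_closed haM (by simpa using hρe) hends')
  rcases hy with hy | hy | hy <;> rcases hz with hz | hz | hz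
  · exact Or.inl ⟨y, by simp [hy], z, by simp [hz], he⟩
  · exact Or.inl ⟨y, by simp [hy], z, by simp [hz], he⟩
  · exact Or.inr (Or.inr (key y z (Or.inl hy) hz he))
  · exact Or.inl ⟨y, by simp [hy], z, by simp [hz], he⟩
  · exact Or.inl ⟨y, by simp [hy], z, by simp [hz], he⟩
  · exact Or.inr (Or.inr (key y z (Or.inr hy) hz he))
  · exact Or.inr (Or.inr (key z y (Or.inl hz) hy (by rw [he, Sym2.eq_swap])))
  · exact Or.inr (Or.inr (key z y (Or.inr hz) hy (by rw [he, Sym2.eq_swap])))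
  · exact Or.inr (Or.inr (mem_freeE.2 (Or.inr (mem_Pk.2 ⟨y, hy, z, hz, he⟩))))

/-- **The cube complement is the colour flip off `{r, s}`.** -/
theorem compl_assignX_eq_cdualP_off_rs {p q r s d : V} (hr : d ≠ r) (hs : d ≠ s) {ρ : Config E}
    (hρ : ρ ∈ RepD ends p q r s d) {x : Finset (Finset V) × Finset E}
    (hx : x ∈ cubeP ends d r s ρ) {e : E} (he : e ∉ within ends ({r, s} : Set V)) :
    OneColourSwitch.compl (assignX ends x ρ) e = assignX ends (cdualP ends d r s ρ x) ρ e := by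
  obtain ⟨hT, hF⟩ := mem_cubeP.1 hx
  have hx' : cdualP ends d r s ρ x ∈ cubeP ends d r s ρ := cdualP_mem_cubeP ρ x
  obtain ⟨hT', hF'⟩ := mem_cubeP.1 hx'
  rcases edge_trichotomy hr hs hρ e with h | ⟨C, hC, y, hy, z, hyz⟩ | h
  · exact (he h).elim
  · simp only [OneColourSwitch.compl]
    rw [assignX_touch_block hρ hT hF hr hs hC hy hyz, assignX_touch_block hρ hT' hF' hr hs hC hy hyz]
    simp only [cdualP, Finset.mem_sdiff, hC, true_and]
    by_cases hCx : C ∈ x.1 <;> simp [hCx]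
  · simp only [OneColourSwitch.compl]
    rw [assignX_freeE hr hs hρ hT h, assignX_freeE hr hs hρ hT' h]
    simp only [cdualP, Finset.mem_sdiff, h, true_and]
    by_cases hex : e ∈ x.2 <;> simp [hex]

omit [Fintype V] [DecidableEq V] [Fintype E] [DecidableEq E] in
/-- Two colourings that agree off the edges inside `{r, s}` have the same `G − d` connections
from a vertex outside the `Y`-world of `G − d`. -/
lemma conn_endsD_of_eqOn_off_rs {d r s : V} (hr : d ≠ r) (hs : d ≠ s) {ω ω' : Config E}
    (h : ∀ e, e ∉ within ends ({r, s} : Set V) → ω e = ω' e) {a b : V}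
    (ha : a ∉ K2 (endsD ends d) r s ω) (hc : Conn (endsD ends d) ω a b) :
    Conn (endsD ends d) ω' a b := by
  refine conn_of_eqOn_notTouches (ends := endsD ends d) (H := ({r, s} : Set V)) ha ?_ hc
  intro e hnt
  refine (h e ?_).symm
  rintro ⟨y, hy, z, hz, hyz⟩
  apply hnt
  have hyd : y ≠ d := by
    rintro rfl
    simp only [Set.mem_insert_iff, Set.mem_singleton_iff] at hy
    rcases hy with h' | h'
    · exact hr h'
    · exact hs h'
  have hzd : z ≠ d := by
    rintro rfl
    simp only [Set.mem_insert_iff, Set.mem_singleton_iff] at hz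
    rcases hz with h' | h'
    · exact hr h'
    · exact hs h'
  refine ⟨y, ?_, z, by rw [endsD_of_notMem (notMem_of_ends_ne hyz hyd hzd), hyz]⟩
  simp only [Set.mem_insert_iff, Set.mem_singleton_iff] at hy
  rcases hy with rfl | rfl
  · exact r_mem_K2 _ _ _
  · exact s_mem_K2 _ _ _

/-- **`Ỹc` at the complement is `W̃c`**: `p ~_Y q` in `G − d` at `cdualP ρ x` iff `p ~_W q` in
`G − d` at `x`. -/
theorem conn_endsD_cdualP_iff {p q r s d : V} (hr : d ≠ r) (hs : d ≠ s) {ρ : Config E}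
    (hρ : ρ ∈ RepD ends p q r s d) {x : Finset (Finset V) × Finset E}
    (hx : x ∈ cubeP ends d r s ρ) :
    Conn (endsD ends d) (assignX ends (cdualP ends d r s ρ x) ρ) p q ↔
      Conn (endsD ends d) (OneColourSwitch.compl (assignX ends x ρ)) p q := by
  obtain ⟨hT, hF⟩ := mem_cubeP.1 hx
  have hx' : cdualP ends d r s ρ x ∈ cubeP ends d r s ρ := cdualP_mem_cubeP ρ x
  obtain ⟨hT', hF'⟩ := mem_cubeP.1 hx'
  have hsep := sep2_endsD_assignX' hr hs hρ hT hF
  have hsep' := sep2_endsD_assignX' hr hs hρ hT' hF'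
  constructor
  · intro hc
    refine conn_endsD_of_eqOn_off_rs hr hs (fun e he => (compl_assignX_eq_cdualP_off_rs hr hs hρ hx he).symm)
      (not_mem_K2_of_sep2 hsep').1 hc
  · intro hc
    refine conn_endsD_of_eqOn_off_rs hr hs (fun e he => compl_assignX_eq_cdualP_off_rs hr hs hρ hx he)
      ?_ hc
    rw [K2_compl]
    exact (not_mem_M2_of_sep2 hsep).1

/-- The indicator of `p ~_Y q` in `G − d` at an assignment. -/
noncomputable def yInd (ends : E → Sym2 V) (p q d : V) (ρ : Config E)
    (x : Finset (Finset V) × Finset E) : ℤ :=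
  if Conn (endsD ends d) (assignX ends x ρ) p q then 1 else 0

/-- `yInd` is non-negative. -/
lemma yInd_nonneg {p q d : V} (ρ : Config E) (x : Finset (Finset V) × Finset E) :
    0 ≤ yInd ends p q d ρ x := by
  unfold yInd; split_ifs <;> norm_num

/-- **`σ̃_pq` at an assignment is `yInd x − yInd (cdualP x)`.** -/
theorem sigma_endsD_eq_sub_cdualP {p q r s d : V} (hr : d ≠ r) (hs : d ≠ s) {ρ : Config E}
    (hρ : ρ ∈ RepD ends p q r s d) {x : Finset (Finset V) × Finset E}
    (hx : x ∈ cubeP ends d r s ρ) :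
    sigma (endsD ends d) (assignX ends x ρ) p q =
      yInd ends p q d ρ x - yInd ends p q d ρ (cdualP ends d r s ρ x) := by
  simp only [sigma, yInd, conn_endsD_cdualP_iff hr hs hρ hx]
  by_cases h1 : Conn (endsD ends d) (assignX ends x ρ) p q <;>
    by_cases h2 : Conn (endsD ends d) (OneColourSwitch.compl (assignX ends x ρ)) p q <;>
    simp [h1, h2]

end Compl

end NoPocket

end Summit.Ventures.PercRepro2
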